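import Literature.Computability.MetaComplexity.EFLayout
import Literature.Computability.MetaComplexity.EFOrder
import HarnessLib

/-!
# Modular addition in extended Frege: the template `x ⊕ₙ y` and its views

Layer D/1 of the `EF`-proof construction kit (`EFScaffold.lean`, `EFNetlist.lean`,
`EFLayout.lean`): addition modulo the parameter word `n` on `W`-bit words, by the textbook
circuit "add, compare with `n`, subtract `n` if not smaller":

* `s = x + y` (`W+1` bits, ripple adder `Adder.addT`),
* `G = [s ≥ n]` and `d = s - n` (the complement-adder comparator/subtractor `Sub.subT (W+1)` on
  `s` and `n` zero-extended by a `⊥` gate),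
* `uᵢ = G ? dᵢ : sᵢ` (`i < W`, the result word `x ⊕ₙ y`),
* a comparator `Sub.subT W` of the result with `n` (its carry-out `[u ≥ n]` is the *domain wire*:
  the laws of modular arithmetic hold for words `< n`, and `¬[u ≥ n]` certifies the result).

For `x, y < n` the result is the canonical residue `(x + y) mod n`. This file fixes the template
(`ModAdd.addModT W`, a `Netlist.layout` of five pieces), its well-formedness, the *views* of its
pieces for an arbitrary occurrence (`ModAdd.A`, `.S`, `.u`, `.C`, …) and their availability from
the availability of the occurrence (`ModAdd.avail`), in the form consumed by the laws of the
adder, subtractor and order layers. The laws of `⊕ₙ` (commutativity, domain closure, unit,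
associativity) follow in the sequels.

## Sources

* H. Vollmer, *Introduction to Circuit Complexity* (Springer 1999), §1.1–1.2 (addition,
  subtraction by complement, multiplexers; composition of circuits).
* J. Krajíček, *Bounded Arithmetic, Propositional Logic, and Complexity Theory* (CUP 1995), §9.2
  (the elementary laws of binary arithmetic have polynomial-size `EF` proofs — the provenance of
  the programme; here constructed directly).
-/

namespace Literature.Computability.MetaComplexity

open _root_.Computability Complexity Complexity.PropForm FregeSystem Netlist

namespace ModAdd

/-! ### The template -/

/-- The row of `W` multiplexers `uᵢ = G ? dᵢ : sᵢ` on the inputs `[G, d₀…d_{W-1}, s₀…s_{W-1}]`.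
[cite: Vollmer1999, §1.1] -/
def muxRow (W : ℕ) : Template :=
  (List.range W).map fun i => ⟨Kind.mux, [Sum.inl 0, Sum.inl (1 + i), Sum.inl (1 + W + i)]⟩

/-- Length of the multiplexer row. [folklore] -/
@[simp] theorem length_muxRow (W : ℕ) : (muxRow W).length = W := by simp [muxRow]

/-- Gates of the multiplexer row. [folklore] -/
theorem getElem_muxRow (W : ℕ) {i : ℕ} (h : i < (muxRow W).length) :
    (muxRow W)[i] = ⟨Kind.mux, [Sum.inl 0, Sum.inl (1 + i), Sum.inl (1 + W + i)]⟩ := by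
  simp [muxRow]

/-- The multiplexer row is well formed (`2W + 1` inputs). [cite: Vollmer1999, Def. 1.6] -/
theorem wf_muxRow (W : ℕ) : (muxRow W).WF (2 * W + 1) := by
  intro k hk
  rw [getElem_muxRow]
  refine ⟨rfl, fun a ha => ?_⟩
  simp only [List.mem_cons, List.not_mem_nil, or_false] at ha
  have hk' : k < W := by simpa using hk
  rcases ha with rfl | rfl | rfl
  · exact ⟨fun i hi => by cases hi; omega, fun j hj => by cases hj⟩
  · exact ⟨fun i hi => by cases hi; omega, fun j hj => by cases hj⟩
  · exact ⟨fun i hi => by cases hi; omega, fun j hj => by cases hj⟩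

/-- Wiring of the `(W+1)`-bit comparator/subtractor: minuend `s₀…s_{W-1}, c_W` (sum bits and
carry-out of the adder at offset `0`), subtrahend `n₀…n_{W-1}` (inputs `2W…3W-1`) and the `⊥`
gate (at `2W+1`). [folklore] -/
def wireCmp (W i : ℕ) : ℕ ⊕ ℕ :=
  if i < W then Sum.inr (2 * i + 1) else if i = W then Sum.inr (2 * W)
  else if i < 2 * W + 1 then Sum.inl (2 * W + (i - (W + 1))) else Sum.inr (2 * W + 1)

/-- Wiring of the multiplexer row: the selector `G` (carry-out of the comparator at offset
`2W+2`), the difference bits `dᵢ`, the sum bits `sᵢ`. [folklore] -/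
def wireMux (W i : ℕ) : ℕ ⊕ ℕ :=
  if i = 0 then Sum.inr (5 * W + 5) else if i ≤ W then Sum.inr (3 * W + 4 + 2 * (i - 1))
  else Sum.inr (2 * (i - 1 - W) + 1)

/-- Wiring of the domain comparator: the result bits `uᵢ` (at offset `5W+6`) and `n`. [folklore] -/
def wireDom (W i : ℕ) : ℕ ⊕ ℕ := if i < W then Sum.inr (5 * W + 6 + i) else Sum.inl (2 * W + (i - W))

/-- The comparator reads the sum bits. [folklore] -/
theorem wireCmp_s (W : ℕ) {i : ℕ} (hi : i < W) : wireCmp W i = Sum.inr (2 * i + 1) := by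
  simp [wireCmp, hi]

/-- The comparator reads the carry-out. [folklore] -/
theorem wireCmp_c (W : ℕ) : wireCmp W W = Sum.inr (2 * W) := by simp [wireCmp]

/-- The comparator reads `n`. [folklore] -/
theorem wireCmp_n (W : ℕ) {i : ℕ} (hi : i < W) : wireCmp W (W + 1 + i) = Sum.inl (2 * W + i) := by
  unfold wireCmp
  rw [if_neg (by omega), if_neg (by omega), if_pos (by omega)]
  congr 1
  omega

/-- The comparator reads the `⊥` gate as the top bit of `n`. [folklore] -/
theorem wireCmp_f (W : ℕ) : wireCmp W (W + 1 + W) = Sum.inr (2 * W + 1) := by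
  unfold wireCmp
  rw [if_neg (by omega), if_neg (by omega), if_neg (by omega)]

/-- The multiplexers read the selector. [folklore] -/
theorem wireMux_zero (W : ℕ) : wireMux W 0 = Sum.inr (5 * W + 5) := by simp [wireMux]

/-- The multiplexers read the difference bits. [folklore] -/
theorem wireMux_d (W : ℕ) {i : ℕ} (hi : i < W) : wireMux W (1 + i) = Sum.inr (3 * W + 4 + 2 * i) := by
  unfold wireMux
  rw [if_neg (by omega), if_pos (by omega)]
  congr 2
  omega

/-- The multiplexers read the sum bits. [folklore] -/
theorem wireMux_s (W : ℕ) {i : ℕ} (hi : i < W) : wireMux W (1 + W + i) = Sum.inr (2 * i + 1) := by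
  unfold wireMux
  rw [if_neg (by omega), if_neg (by omega)]
  congr 2
  omega

/-- The domain comparator reads the result bits. [folklore] -/
theorem wireDom_u (W : ℕ) {i : ℕ} (hi : i < W) : wireDom W i = Sum.inr (5 * W + 6 + i) := by simp [wireDom, hi]

/-- The domain comparator reads `n`. [folklore] -/
theorem wireDom_n (W i : ℕ) : wireDom W (W + i) = Sum.inl (2 * W + i) := by
  unfold wireDom
  rw [if_neg (by omega)]
  congr 1
  omega

/-- The five pieces of `x ⊕ₙ y`: the adder, the `⊥` gate, the comparator/subtractor with `n`,
the multiplexer row, the domain comparator. [cite: Vollmer1999, §1.2] -/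
def pieces (W : ℕ) : ℕ → Piece
  | 0 => ⟨Adder.addT false W, 2 * W, Sum.inl⟩
  | 1 => ⟨[⟨Kind.cst false, []⟩], 0, Sum.inl⟩
  | 2 => ⟨Sub.subT (W + 1), 2 * (W + 1), wireCmp W⟩
  | 3 => ⟨muxRow W, 2 * W + 1, wireMux W⟩
  | _ => ⟨Sub.subT W, 2 * W, wireDom W⟩

/-- **The modular-addition template** `x ⊕ₙ y` on the inputs `x` (`0…W-1`), `y` (`W…2W-1`),
`n` (`2W…3W-1`). [cite: Vollmer1999, §1.1–1.2] -/
def addModT (W : ℕ) : Template := layout (pieces W) 5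

/-- The offsets of the five pieces. [folklore] -/
theorem offset_pieces (W : ℕ) :
    offset (pieces W) 0 = 0 ∧ offset (pieces W) 1 = 2 * W + 1 ∧ offset (pieces W) 2 = 2 * W + 2 ∧
      offset (pieces W) 3 = 5 * W + 6 ∧ offset (pieces W) 4 = 6 * W + 6 ∧ offset (pieces W) 5 = 9 * W + 7 := by
  have h1 : offset (pieces W) 1 = 2 * W + 1 := by rw [offset_succ, offset_zero]; simp [pieces]
  have h2 : offset (pieces W) 2 = 2 * W + 2 := by rw [offset_succ, h1]; simp [pieces]
  have h3 : offset (pieces W) 3 = 5 * W + 6 := by rw [offset_succ, h2]; simp [pieces]; ring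
  have h4 : offset (pieces W) 4 = 6 * W + 6 := by rw [offset_succ, h3]; simp [pieces]; ring
  have h5 : offset (pieces W) 5 = 9 * W + 7 := by rw [offset_succ, h4]; simp [pieces]; ring
  exact ⟨rfl, h1, h2, h3, h4, h5⟩

/-- Size of the modular-addition template: `9W + 7` gates. [folklore] -/
@[simp] theorem length_addModT (W : ℕ) : (addModT W).length = 9 * W + 7 := by
  rw [addModT, length_layout]
  exact (offset_pieces W).2.2.2.2.2

/-- Every piece is well formed and well wired (`3W` inputs). [cite: Vollmer1999, Def. 1.6] -/
theorem piece_ok (W : ℕ) : ∀ k < 5, Piece.OK (pieces W) (3 * W) k := by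
  obtain ⟨h0, h1, h2, h3, h4, -⟩ := offset_pieces W
  intro k hk
  have hk' : k = 0 ∨ k = 1 ∨ k = 2 ∨ k = 3 ∨ k = 4 := by omega
  rcases hk' with rfl | rfl | rfl | rfl | rfl
  · refine ⟨Adder.wf_addT false W, fun i hi => ⟨fun a ha => ?_, fun g hg => ?_⟩⟩
    · simp only [pieces, Sum.inl.injEq] at ha hi; omega
    · simp [pieces] at hg
  · refine ⟨?_, fun i hi => absurd hi (Nat.not_lt_zero i)⟩
    intro k hk
    simp only [pieces, List.length_singleton, Nat.lt_one_iff] at hk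
    subst hk
    exact ⟨rfl, fun a ha => absurd ha List.not_mem_nil⟩
  · refine ⟨Sub.wf_subT (W + 1), fun i hi => ?_⟩
    simp only [pieces] at hi ⊢
    rw [h2]
    by_cases hiW : i < W
    · rw [wireCmp_s W hiW]; exact ⟨fun a ha => (by cases ha), fun g hg => by cases hg; omega⟩
    by_cases hiW' : i = W
    · rw [hiW', wireCmp_c]; exact ⟨fun a ha => (by cases ha), fun g hg => by cases hg; omega⟩
    by_cases hi2 : i < W + 1 + W
    · obtain ⟨j, rfl⟩ : ∃ j, i = W + 1 + j := ⟨i - (W + 1), by omega⟩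
      rw [wireCmp_n W (by omega)]; exact ⟨fun a ha => (by cases ha; omega), fun g hg => by cases hg⟩
    · rw [show i = W + 1 + W by omega, wireCmp_f]; exact ⟨fun a ha => (by cases ha), fun g hg => by cases hg; omega⟩
  · refine ⟨wf_muxRow W, fun i hi => ?_⟩
    simp only [pieces] at hi ⊢
    rw [h3]
    rcases i with _ | i
    · rw [wireMux_zero]; exact ⟨fun a ha => (by cases ha), fun g hg => by cases hg; omega⟩
    by_cases hiW : i < W
    · rw [show i + 1 = 1 + i by ring, wireMux_d W hiW]; exact ⟨fun a ha => (by cases ha), fun g hg => by cases hg; omega⟩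
    · obtain ⟨j, rfl⟩ : ∃ j, i = W + j := ⟨i - W, by omega⟩
      rw [show W + j + 1 = 1 + W + j by ring, wireMux_s W (by omega)]
      exact ⟨fun a ha => (by cases ha), fun g hg => by cases hg; omega⟩
  · refine ⟨Sub.wf_subT W, fun i hi => ?_⟩
    simp only [pieces] at hi ⊢
    rw [h4]
    by_cases hiW : i < W
    · rw [wireDom_u W hiW]; exact ⟨fun a ha => (by cases ha), fun g hg => by cases hg; omega⟩
    · obtain ⟨j, rfl⟩ : ∃ j, i = W + j := ⟨i - W, by omega⟩
      rw [wireDom_n W]; exact ⟨fun a ha => (by cases ha; omega), fun g hg => by cases hg⟩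

/-- **The modular-addition template is well formed** (`3W` inputs). [cite: Vollmer1999, Def. 1.6] -/
theorem wf_addModT (W : ℕ) : (addModT W).WF (3 * W) := wf_layout (pieces W) (piece_ok W)

/-! ### Views of an occurrence -/

variable (W : ℕ) (o : Occ)

/-- The adder `s = x + y` of an occurrence. [folklore] -/
def A : Adder.View := ⟨o.base, o.inp, fun i => o.inp (W + i)⟩

/-- The parameter word `n` of an occurrence. [folklore] -/
def nv : ℕ → ℕ := fun i => o.inp (2 * W + i)

/-- The `⊥` gate of an occurrence. [folklore] -/
def f : ℕ := o.base + (2 * W + 1)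

/-- The comparator/subtractor of `s` (as a `W+1`-bit word) with `n` (zero-extended).
[folklore] -/
def S : Sub.View := ⟨o.base + (2 * W + 2), Adder.extOut (A W o) W, Adder.zext (nv W o) (f W o) W⟩

/-- The selector `G = [s ≥ n]` (gate `sel`). [folklore] -/
def sel : ℕ := (S W o).ge (W + 1) (W + 1)

/-- The difference bits `d = s - n`. [folklore] -/
def d : ℕ → ℕ := (S W o).d (W + 1)

/-- The result word `u = x ⊕ₙ y` (the multiplexer gates). [folklore] -/
def u : ℕ → ℕ := fun i => o.base + (5 * W + 6 + i)

/-- The domain comparator of the result with `n`. [folklore] -/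
def C : Sub.View := ⟨o.base + (6 * W + 6), u W o, nv W o⟩

/-- The domain wire `[u ≥ n]` (its negation certifies `u < n`). [folklore] -/
def domv : ℕ := (C W o).ge W W

/-- `ModAdd.Views W o K Γ`: the definition lines of all pieces of the occurrence, in view form,
are available. [folklore] -/
structure Views (K : PropForm ℕ) (Γ : Set (PropForm ℕ)) : Prop where
  /-- the adder -/
  adder : (A W o).Avail K Γ false W
  /-- the `⊥` gate -/
  bot : ctx K (biimp (var (f W o)) (const false)) ∈ Γ
  /-- the comparator/subtractor with `n` -/
  cmp : (S W o).Avail K Γ (W + 1)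
  /-- the multiplexers -/
  mux : ∀ i < W, ctx K (muxRel (sel W o) (u W o i) (d W o i) ((A W o).s i)) ∈ Γ
  /-- the domain comparator -/
  domc : (C W o).Avail K Γ W

variable {W o}

/-- Availability of the views is monotone. [folklore] -/
theorem Views.mono {K : PropForm ℕ} {Γ Γ' : Set (PropForm ℕ)} (h : Views W o K Γ) (hΓ : Γ ⊆ Γ') : Views W o K Γ' :=
  ⟨h.adder.mono hΓ, hΓ h.bot, h.cmp.mono hΓ, fun i hi => hΓ (h.mux i hi), h.domc.mono hΓ⟩

/-- **An available occurrence of `x ⊕ₙ y` provides all views.** [folklore] -/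
theorem avail {K : PropForm ℕ} {Γ : Set (PropForm ℕ)} (ho : o.Avail (addModT W) (3 * W) K Γ) : Views W o K Γ := by
  obtain ⟨h0, h1, h2, h3, h4, -⟩ := offset_pieces W
  have hI : (o.inst (3 * W)).DefsAvail (layout (pieces W) 5) K Γ := ho
  have href : ∀ i < 3 * W, (o.inst (3 * W)).ref (Sum.inl i) = o.inp i := fun i hi => o.ref_inl hi
  refine ⟨?_, ?_, ?_, ?_, ?_⟩
  · -- the adder, piece 0 at offset 0
    have h := Adder.avail_viewEmb (c₀ := false) (W := W) (off := 0) (w := Sum.inl) hI fun k hk =>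
      getElem_layout (pieces W) (k := 0) (N := 5) (by omega) hk
    refine h.congr rfl (fun i hi => ?_) fun i hi => ?_
    · exact (href i (by omega)).symm
    · exact (href (W + i) (by omega)).symm
  · -- the `⊥` gate, piece 1
    obtain ⟨hk, heq⟩ := getElem_layout (pieces W) (k := 1) (N := 5) (j := 0) (by omega) (by simp [pieces])
    have h := hI (offset (pieces W) 1 + 0) hk
    rw [heq] at h
    rw [h1] at h
    exact h
  · -- the comparator, piece 2
    have h := Sub.avail_viewEmb (w := W + 1) (off := offset (pieces W) 2) (wv := wireCmp W) hI fun k hk =>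
      getElem_layout (pieces W) (k := 2) (N := 5) (by omega) hk
    rw [h2] at h
    refine h.congr rfl (fun i hi => ?_) fun i hi => ?_
    · show Adder.extOut (A W o) W i = (o.inst (3 * W)).ref (wireCmp W i)
      rcases Nat.lt_succ_iff_lt_or_eq.1 hi with hi' | hi'
      · rw [Adder.extOut_lt _ hi', wireCmp_s W hi']; rfl
      · rw [hi', Adder.extOut_top, wireCmp_c]; rfl
    · show Adder.zext (nv W o) (f W o) W i = (o.inst (3 * W)).ref (wireCmp W (W + 1 + i))
      rcases Nat.lt_succ_iff_lt_or_eq.1 hi with hi' | hi'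
      · rw [Adder.zext_lt _ _ hi', wireCmp_n W hi', href _ (by omega)]; rfl
      · rw [hi', Adder.zext_top, wireCmp_f]; rfl
  · -- the multiplexers, piece 3
    intro i hi
    obtain ⟨hk, heq⟩ := getElem_layout (pieces W) (k := 3) (N := 5) (j := i) (by omega) (by simpa [pieces] using hi)
    have h := hI (offset (pieces W) 3 + i) hk
    rw [heq] at h
    rw [h3] at h
    have hg : (pieces W 3).T[i]'(by simpa [pieces] using hi) = ⟨Kind.mux, [Sum.inl 0, Sum.inl (1 + i), Sum.inl (1 + W + i)]⟩ :=
      getElem_muxRow W _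
    rw [hg] at h
    have e : (o.inst (3 * W)).body ⟨Kind.mux, [Sum.inl 0, Sum.inl (1 + i), Sum.inl (1 + W + i)].map (remap (pieces W 3).wire (5 * W + 6))⟩ =
        muxF (var (sel W o)) (var (d W o i)) (var ((A W o).s i)) := by
      show muxF (var ((o.inst (3 * W)).ref (remap (wireMux W) (5 * W + 6) (Sum.inl 0))))
          (var ((o.inst (3 * W)).ref (remap (wireMux W) (5 * W + 6) (Sum.inl (1 + i)))))
          (var ((o.inst (3 * W)).ref (remap (wireMux W) (5 * W + 6) (Sum.inl (1 + W + i))))) = _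
      simp only [remap, wireMux_zero, wireMux_d W hi, wireMux_s W hi, Occ.ref_inr]
      simp only [sel, d, S, A, Sub.View.ge, Sub.View.d, Sub.View.adder, Adder.View.c, Adder.View.s, Adder.View.wire, Occ.wire]
      congr 2 <;> ring
    rw [e] at h
    exact h
  · -- the domain comparator, piece 4
    have h := Sub.avail_viewEmb (w := W) (off := offset (pieces W) 4) (wv := wireDom W) hI fun k hk =>
      getElem_layout (pieces W) (k := 4) (N := 5) (by omega) hk
    rw [h4] at h
    refine h.congr rfl (fun i hi => ?_) fun i hi => ?_
    · show u W o i = (o.inst (3 * W)).ref (wireDom W i)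
      rw [wireDom_u W hi]
      simp [u, Occ.wire, Nat.add_assoc]
    · show nv W o i = (o.inst (3 * W)).ref (wireDom W (W + i))
      rw [wireDom_n W i, href _ (by omega)]
      rfl

/-! ### Picking sub-words out of a congruence of occurrences -/

/-- The result bits are wires `5W+6+i`. [folklore] -/
theorem u_eq_wire (i : ℕ) : u W o i = o.wire (5 * W + 6 + i) := rfl

/-- The domain wire is wire `9W+6`. [folklore] -/
theorem domv_eq_wire : domv W o = o.wire (9 * W + 6) := by
  simp [domv, C, Sub.View.ge, Sub.View.adder, Adder.View.c, Adder.View.wire, Occ.wire]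
  ring

/-! ### Rules of the modular-addition layer -/

/-- Zero first operand, sum: `s = x ⊕ y ⊕ c`, `¬x`, `¬c` give `s ↔ y`. [cite: CookReckhow1979, §2 (sound rule)] -/
def rZeroSumL : FregeRule :=
  ⟨[ctx (var 0) (biimp (var 1) (xor3F (var 2) (var 3) (var 4))), ctx (var 0) (neg (var 2)), ctx (var 0) (neg (var 4))],
   ctx (var 0) (eqv 1 3)⟩

/-- Zero first operand, carry: `c⁺ = maj(x, y, c)`, `¬x`, `¬c` give `¬c⁺`. [cite: CookReckhow1979, §2 (sound rule)] -/
def rZeroCarryL : FregeRule :=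
  ⟨[ctx (var 0) (biimp (var 1) (majF (var 2) (var 3) (var 4))), ctx (var 0) (neg (var 2)), ctx (var 0) (neg (var 4))],
   ctx (var 0) (neg (var 1))⟩

/-- Top position of a comparator whose top operand bits are both false: `ny ↔ ¬y`,
`g' ↔ maj(x, ny, g)`, `¬x`, `¬y` give `g' ↔ g`. [cite: CookReckhow1979, §2 (sound rule)] -/
def rTopEqv : FregeRule :=
  ⟨[ctx (var 0) (biimp (var 1) (neg (var 2))), ctx (var 0) (biimp (var 3) (majF (var 4) (var 1) (var 5))),
    ctx (var 0) (neg (var 4)), ctx (var 0) (neg (var 2))], ctx (var 0) (eqv 3 5)⟩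

/-- `b ↔ ¬g` and `g` give `¬b`. [cite: CookReckhow1979, §2 (sound rule)] -/
def rNegEqvT : FregeRule := ⟨[ctx (var 0) (biimp (var 1) (neg (var 2))), ctx (var 0) (var 2)], ctx (var 0) (neg (var 1))⟩

/-- `b ↔ ¬g` and `¬g` give `b`. [cite: CookReckhow1979, §2 (sound rule)] -/
def rNegEqvF : FregeRule := ⟨[ctx (var 0) (biimp (var 1) (neg (var 2))), ctx (var 0) (neg (var 2))], ctx (var 0) (var 1)⟩

/-- Sum bit of an adder position with equal false operand bits: `s = f ⊕ f ⊕ c`, `¬f` give `s ↔ c`.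
[cite: CookReckhow1979, §2 (sound rule)] -/
def rExtSum : FregeRule := ⟨[ctx (var 0) (biimp (var 1) (xor3F (var 2) (var 2) (var 3))), ctx (var 0) (neg (var 2))], ctx (var 0) (eqv 1 3)⟩

/-- Carry of an adder position with equal false operand bits: `c' = maj(f, f, c)`, `¬f` give `¬c'`.
[cite: CookReckhow1979, §2 (sound rule)] -/
def rExtCarry : FregeRule := ⟨[ctx (var 0) (biimp (var 1) (majF (var 2) (var 2) (var 3))), ctx (var 0) (neg (var 2))], ctx (var 0) (neg (var 1))⟩

/-- The rules of the modular-addition layer. [cite: CookReckhow1979, §2] -/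
def rules : List FregeRule := [rZeroSumL, rZeroCarryL, rTopEqv, rNegEqvT, rNegEqvF, rExtSum, rExtCarry]

/-- Every rule of the layer is sound (truth tables). [cite: CookReckhow1979, §2 (sound rule)] -/
theorem isSound_of_mem_rules : ∀ r ∈ rules, r.IsSound := by
  intro r hr
  simp only [rules, List.mem_cons, List.not_mem_nil, or_false] at hr
  rcases hr with rfl | rfl | rfl | rfl | rfl | rfl | rfl <;> exact FregeRule.isSound_of_check (by decide +kernel)

/-- Membership in `rules`, by position. [folklore] -/
theorem mem_rules : rZeroSumL ∈ rules ∧ rZeroCarryL ∈ rules ∧ rTopEqv ∈ rules ∧ rNegEqvT ∈ rules ∧ rNegEqvF ∈ rules ∧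
    rExtSum ∈ rules ∧ rExtCarry ∈ rules := by
  simp [rules]

/-- `RulesOK G`: the rule list `G` contains all layers used by the laws of modular addition.
[folklore] -/
structure RulesOK (G : FregeSystem) : Prop where
  /-- Leibniz rules -/
  netlist : ∀ r ∈ Netlist.rules, r ∈ G.rules
  /-- propositional bookkeeping -/
  logic : ∀ r ∈ Logic.rules, r ∈ G.rules
  /-- adder layer -/
  adder : ∀ r ∈ Adder.rules, r ∈ G.rules
  /-- adder laws -/
  adderLaw : ∀ r ∈ Adder.lawRules, r ∈ G.rules
  /-- subtractor layer -/
  sub : ∀ r ∈ Sub.rules, r ∈ G.rules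
  /-- order layer -/
  order : ∀ r ∈ Sub.orderRules, r ∈ G.rules
  /-- multiplexer naturality -/
  muxNat : ∀ r ∈ muxNatRules, r ∈ G.rules
  /-- this layer -/
  modAdd : ∀ r ∈ rules, r ∈ G.rules

/-- The concatenation of all rule layers used so far. [folklore] -/
def allRules : List FregeRule :=
  Netlist.rules ++ Logic.rules ++ Adder.rules ++ Adder.lawRules ++ Sub.rules ++ Sub.orderRules ++ muxNatRules ++ rules

/-- `allRules` contains every layer. [folklore] -/
theorem rulesOK_allRules : RulesOK ⟨allRules⟩ := by
  refine ⟨?_, ?_, ?_, ?_, ?_, ?_, ?_, ?_⟩ <;> intro r hr <;> simp only [allRules, List.mem_append] <;> tauto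

/-- Every rule of `allRules` is sound. [cite: CookReckhow1979, §2 (sound rule)] -/
theorem isSound_allRules : ∀ r ∈ allRules, r.IsSound := by
  intro r hr
  simp only [allRules, List.mem_append] at hr
  rcases hr with ((((((hr | hr) | hr) | hr) | hr) | hr) | hr) | hr
  exacts [Netlist.isSound_of_mem_rules r hr, Logic.isSound_of_mem_rules r hr, Adder.isSound_of_mem_rules r hr,
    Adder.isSound_of_mem_lawRules r hr, Sub.isSound_of_mem_rules r hr, Sub.isSound_of_mem_orderRules r hr,
    isSound_of_mem_muxNatRules r hr, isSound_of_mem_rules r hr]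

/-! ### Certificates `x < n` -/

/-- `LtN W K Γ x n`: a `W`-bit comparator of the word `x` with the word `n` is available and
provably answers `x < n`. This is the *domain certificate* under which the laws of modular
arithmetic hold. [folklore] -/
def LtN (W : ℕ) (K : PropForm ℕ) (Γ : Set (PropForm ℕ)) (x n : ℕ → ℕ) : Prop :=
  ∃ b : ℕ, (⟨b, x, n⟩ : Sub.View).Avail K Γ W ∧ ctx K (neg (var ((⟨b, x, n⟩ : Sub.View).ge W W))) ∈ Γ

/-- Certificates are monotone. [folklore] -/
theorem LtN.mono {W : ℕ} {K : PropForm ℕ} {Γ Γ' : Set (PropForm ℕ)} {x n : ℕ → ℕ} (h : LtN W K Γ x n) (hΓ : Γ ⊆ Γ') :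
    LtN W K Γ' x n := by
  obtain ⟨b, hb, hlt⟩ := h
  exact ⟨b, hb.mono hΓ, hΓ hlt⟩

/-- Certificates only depend on the words below `W`. [folklore] -/
theorem LtN.congr {W : ℕ} {K : PropForm ℕ} {Γ : Set (PropForm ℕ)} {x n x' n' : ℕ → ℕ} (h : LtN W K Γ x n)
    (hx : ∀ i < W, x' i = x i) (hn : ∀ i < W, n' i = n i) : LtN W K Γ x' n' := by
  obtain ⟨b, hb, hlt⟩ := h
  exact ⟨b, hb.congr rfl hx hn, hlt⟩

/-! ### Generic blocks on subtractor and adder views -/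

section Generic

variable {G : FregeSystem} {K : PropForm ℕ} {Γ : Set (PropForm ℕ)}

/-- Availability of an adder view restricts to a prefix of the positions. [folklore] -/
theorem _root_.Literature.Computability.MetaComplexity.Adder.View.Avail.of_le {V : Adder.View} {c₀ : Bool} {W W' : ℕ}
    (h : V.Avail K Γ c₀ W') (hW : W ≤ W') : V.Avail K Γ c₀ W :=
  ⟨h.1, fun i hi => h.2 i (lt_of_lt_of_le hi hW)⟩

/-- The lines linking two comparators on a common prefix: complement gates, then inner adder wires.
[folklore] -/
def linkLines (V C : Sub.View) (wV wC W : ℕ) : List (PropForm ℕ) :=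
  (List.range W).map (fun j => eqv (V.ny j) (C.ny j)) ++
    (List.range (2 * W + 1)).map fun k => eqv ((V.adder wV).wire k) ((C.adder wC).wire k)

/-- **Linking two comparators on a common prefix**: two subtractor/comparator views (of widths
`wV, wC ≥ W`) whose operands provably agree below `W` have provably equal complement gates and
inner-adder wires below position `W` — in particular equal comparison carries `ge W`.
[cite: CookReckhow1979, §2] -/
theorem linkLow (hG : RulesOK G) (V C : Sub.View) {wV wC W : ℕ} (hV : V.Avail K Γ wV) (hC : C.Avail K Γ wC)
    (hWV : W ≤ wV) (hWC : W ≤ wC) (hx : ∀ i < W, ctx K (eqv (V.x i) (C.x i)) ∈ Γ)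
    (hy : ∀ i < W, ctx K (eqv (V.y i) (C.y i)) ∈ Γ) :
    G.Yields Γ (ctxSet K (linkLines V C wV wC W)) ((3 * W + 1) * (K.size + 10)) := by
  have h₁ : G.Yields Γ (ctxSet K ((List.range W).map fun j => eqv (V.ny j) (C.ny j))) (W * (K.size + 9 + 1)) :=
    Yields.ctx_range (fun j hj => Or.inr (Logic.infer hG.logic 17 (by decide)
      (FregeSystem.sub [K, var (V.ny j), var (V.y j), var (C.ny j), var (C.y j)]) rfl
      (FregeSystem.prems_cons (hV.1 j (lt_of_lt_of_le hj hWV)) (FregeSystem.prems_cons (hC.1 j (lt_of_lt_of_le hj hWC))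
        (FregeSystem.prems_cons (hy j hj) FregeSystem.prems_nil))))) fun j _ => (size_eqv _ _).le
  have h₂ : G.Yields (Γ ∪ ctxSet K ((List.range W).map fun j => eqv (V.ny j) (C.ny j)))
      (ctxSet K ((List.range (2 * W + 1)).map fun k => eqv ((V.adder wV).wire k) ((C.adder wC).wire k)))
      ((2 * W + 1) * (K.size + 10)) := by
    refine Yields.of_isBlock (Adder.isBlock_leibLines hG.netlist (V.adder wV) (C.adder wC)
      ((hV.2.of_le hWV).mono Set.subset_union_left) ((hC.2.of_le hWC).mono Set.subset_union_left)
      (fun i hi => Or.inl (hx i hi)) fun i hi => Or.inr (mem_ctxSet (List.mem_map.2 ⟨i, List.mem_range.2 hi, rfl⟩))) ?_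
      (Adder.proofSize_leibLines _ _ _ _)
    rintro θ ⟨L, hL, rfl⟩
    obtain ⟨k, hk, rfl⟩ := List.mem_map.1 hL
    exact Adder.mem_leibLines (List.mem_range.1 hk)
  have h := h₁.trans h₂
  rw [← ctxSet_append] at h
  exact h.mono_size (by nlinarith)

/-- The comparison carries at `W` are linked. [folklore] -/
theorem ge_mem_linkLines (V C : Sub.View) (wV wC W : ℕ) : eqv (V.ge wV W) (C.ge wC W) ∈ linkLines V C wV wC W :=
  List.mem_append_right _ (List.mem_map.2 ⟨2 * W, List.mem_range.2 (by omega), rfl⟩)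

/-- The difference bits below `W` are linked. [folklore] -/
theorem d_mem_linkLines (V C : Sub.View) (wV wC : ℕ) {W i : ℕ} (hi : i < W) : eqv (V.d wV i) (C.d wC i) ∈ linkLines V C wV wC W :=
  List.mem_append_right _ (List.mem_map.2 ⟨2 * i + 1, List.mem_range.2 (by omega), rfl⟩)

/-- **Transport of a certificate**: if `x < n` is certified and the operands of an available
comparator `C` provably equal `x` and `n`, then `C` answers `<` as well. [cite: CookReckhow1979, §2] -/
theorem LtN.transport (hG : RulesOK G) {W : ℕ} {x n : ℕ → ℕ} (h : LtN W K Γ x n) (C : Sub.View) {wC : ℕ}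
    (hC : C.Avail K Γ wC) (hWC : W ≤ wC) (hx : ∀ i < W, ctx K (eqv (x i) (C.x i)) ∈ Γ)
    (hn : ∀ i < W, ctx K (eqv (n i) (C.y i)) ∈ Γ) :
    G.Yields Γ {ctx K (neg (var (C.ge wC W)))} ((3 * W + 2) * (K.size + 10)) := by
  obtain ⟨b, hb, hlt⟩ := h
  have h₁ := linkLow hG ⟨b, x, n⟩ C hb hC le_rfl hWC hx hn
  have h₂ : G.Yields (Γ ∪ ctxSet K (linkLines ⟨b, x, n⟩ C W wC W)) {ctx K (neg (var (C.ge wC W)))} (K.size + 3) := by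
    have h' := Yields.single (Logic.infer hG.logic 8 (by decide) (S := Γ ∪ ctxSet K (linkLines ⟨b, x, n⟩ C W wC W))
      (FregeSystem.sub [K, var ((⟨b, x, n⟩ : Sub.View).ge W W), var (C.ge wC W)]) (θ := ctx K (neg (var (C.ge wC W)))) rfl
      (FregeSystem.prems_cons (Or.inl hlt) (FregeSystem.prems_cons (Or.inr (mem_ctxSet (ge_mem_linkLines _ _ _ _ _)))
        FregeSystem.prems_nil)))
    exact h'.mono_size (by simp [ctx, size])
  exact ((h₁.trans h₂).mono_right Set.subset_union_right).mono_size (by nlinarith)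

/-- The lines of the zero-left law: `¬cᵢ` (line `2i`) and `sᵢ ↔ yᵢ` (line `2i+1`). [folklore] -/
def zeroLLine (P : Adder.View) (k : ℕ) : PropForm ℕ :=
  if k % 2 = 0 then neg (var (P.c (k / 2))) else eqv (P.s (k / 2)) (P.y (k / 2))

/-- Even lines. [folklore] -/
theorem zeroLLine_even (P : Adder.View) (i : ℕ) : zeroLLine P (2 * i) = neg (var (P.c i)) := by
  rw [zeroLLine, if_pos (by omega), show 2 * i / 2 = i by omega]

/-- Odd lines. [folklore] -/
theorem zeroLLine_odd (P : Adder.View) (i : ℕ) : zeroLLine P (2 * i + 1) = eqv (P.s i) (P.y i) := by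
  rw [zeroLLine, if_neg (by omega), show (2 * i + 1) / 2 = i by omega]

/-- **Zero first operand**: an adder (carry-in `0`) whose first operand bits are provably false has
provably false carries and sum bits provably equal to the second operand. [cite: CookReckhow1979, §2] -/
theorem zeroL (hG : RulesOK G) (P : Adder.View) {W : ℕ} (hP : P.Avail K Γ false W)
    (hx : ∀ i < W, ctx K (neg (var (P.x i))) ∈ Γ) :
    G.Yields Γ (ctxSet K ((List.range (2 * W + 1)).map (zeroLLine P))) ((2 * W + 1) * (K.size + 10)) := by
  rw [ctxSet_map_range]
  refine Yields.indexed (fun k hk => Or.inr ?_) fun k _ => by unfold zeroLLine; split_ifs <;> simp [ctx, eqv, size, FregeSystem.size_biimp]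
  rcases Adder.index_cases W k hk with rfl | ⟨i, hi, rfl | rfl⟩
  · rw [show (0 : ℕ) = 2 * 0 from rfl, zeroLLine_even]
    exact FregeSystem.IsInferredFrom.of_rule (hG.adderLaw _ Adder.mem_lawRules.1) (FregeSystem.sub [K, var (P.c 0)]) rfl
      (FregeSystem.prems_cons (Or.inl hP.1) FregeSystem.prems_nil)
  · rw [zeroLLine_odd]
    exact FregeSystem.IsInferredFrom.of_rule (hG.modAdd _ mem_rules.1)
      (FregeSystem.sub [K, var (P.s i), var (P.x i), var (P.y i), var (P.c i)]) rfl
      (FregeSystem.prems_cons (Or.inl (hP.2 i hi).1) (FregeSystem.prems_cons (Or.inl (hx i hi))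
        (FregeSystem.prems_cons (Or.inr ⟨2 * i, by omega, by rw [zeroLLine_even]; rfl⟩) FregeSystem.prems_nil)))
  · rw [show 2 * i + 2 = 2 * (i + 1) by ring, zeroLLine_even]
    exact FregeSystem.IsInferredFrom.of_rule (hG.modAdd _ mem_rules.2.1)
      (FregeSystem.sub [K, var (P.c (i + 1)), var (P.x i), var (P.y i), var (P.c i)]) rfl
      (FregeSystem.prems_cons (Or.inl (hP.2 i hi).2) (FregeSystem.prems_cons (Or.inl (hx i hi))
        (FregeSystem.prems_cons (Or.inr ⟨2 * i, by omega, by rw [zeroLLine_even]; rfl⟩) FregeSystem.prems_nil)))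

/-- Conclusions of the zero-left law: the sum bits. [folklore] -/
theorem sum_mem_zeroL (P : Adder.View) {W i : ℕ} (hi : i < W) : eqv (P.s i) (P.y i) ∈ (List.range (2 * W + 1)).map (zeroLLine P) := by
  rw [← zeroLLine_odd]; exact List.mem_map.2 ⟨_, List.mem_range.2 (by omega), rfl⟩

/-- Conclusions of the zero-left law: the carries (`i ≤ W`). [folklore] -/
theorem carry_mem_zeroL (P : Adder.View) {W i : ℕ} (hi : i ≤ W) : neg (var (P.c i)) ∈ (List.range (2 * W + 1)).map (zeroLLine P) := by
  rw [← zeroLLine_even]; exact List.mem_map.2 ⟨_, List.mem_range.2 (by omega), rfl⟩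

/-- **Top position of a comparator with false top operand bits**: `ge (W+1) ↔ ge W`.
[cite: CookReckhow1979, §2] -/
theorem topEqv (hG : RulesOK G) (V : Sub.View) {W : ℕ} (hV : V.Avail K Γ (W + 1)) (hx : ctx K (neg (var (V.x W))) ∈ Γ)
    (hy : ctx K (neg (var (V.y W))) ∈ Γ) : G.Yields Γ {ctx K (eqv (V.ge (W + 1) (W + 1)) (V.ge (W + 1) W))} (K.size + 10) := by
  have h := Yields.single (FregeSystem.IsInferredFrom.of_rule (hG.modAdd _ mem_rules.2.2.1) (S := Γ)
    (FregeSystem.sub [K, var (V.ny W), var (V.y W), var (V.ge (W + 1) (W + 1)), var (V.x W), var (V.ge (W + 1) W)])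
    (θ := ctx K (eqv (V.ge (W + 1) (W + 1)) (V.ge (W + 1) W))) rfl
    (FregeSystem.prems_cons (hV.1 W (Nat.lt_succ_self W)) (FregeSystem.prems_cons (hV.2.2 W (Nat.lt_succ_self W)).2
      (FregeSystem.prems_cons hx (FregeSystem.prems_cons hy FregeSystem.prems_nil)))))
  exact h.mono_size (by simp [ctx, eqv, size, FregeSystem.size_biimp])

end Generic

/-! ### Law: congruence of modular addition -/

variable {G : FregeSystem} {K : PropForm ℕ} {Γ : Set (PropForm ℕ)} {W : ℕ}

/-- **Congruence of `⊕ₙ`**: two available occurrences with provably equal inputs have provably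
equal wires (in particular results and domain wires). [cite: CookReckhow1979, §2] -/
theorem congrOcc (hG : RulesOK G) {o₁ o₂ : Occ} (h₁ : o₁.Avail (addModT W) (3 * W) K Γ) (h₂ : o₂.Avail (addModT W) (3 * W) K Γ)
    (hin : Holds K Γ (eqW o₁.inp o₂.inp (3 * W))) :
    G.Yields Γ (ctxSet K (eqW o₁.wire o₂.wire (9 * W + 7))) ((9 * W + 7) * (K.size + 10)) := by
  have h := Yields.leib hG.netlist (wf_addModT W) (o₁.inst (3 * W)) (o₂.inst (3 * W)) K h₁ h₂ fun i hi => by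
    rw [o₁.getD_inst hi, o₂.getD_inst hi]; exact holds_eqW_iff.1 hin i hi
  rw [length_addModT] at h
  exact h

/-- From the congruence of all wires: the results agree. [folklore] -/
theorem holds_eqW_u_of_wire {o₁ o₂ : Occ} (h : Holds K Γ (eqW o₁.wire o₂.wire (9 * W + 7))) : Holds K Γ (eqW (u W o₁) (u W o₂) W) :=
  holds_eqW_iff.2 fun i hi => holds_eqW_iff.1 h (5 * W + 6 + i) (by omega)

/-- From the congruence of all wires: the domain wires agree. [folklore] -/
theorem eqv_domv_of_wire {o₁ o₂ : Occ} (h : Holds K Γ (eqW o₁.wire o₂.wire (9 * W + 7))) : ctx K (eqv (domv W o₁) (domv W o₂)) ∈ Γ := by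
  rw [domv_eq_wire, domv_eq_wire]; exact holds_eqW_iff.1 h _ (by omega)

/-! ### Law: commutativity of modular addition -/

/-- **Commutativity of `⊕ₙ` inside Frege**: an occurrence on `(x, y)` and one on `(y, x)` (same `n`)
have provably equal results — adder commutativity, then congruence through the `⊥` gate, the
comparator/subtractor and the multiplexers. [cite: CookReckhow1979, §2] [cite: Krajicek1995, §9.2] -/
theorem comm (hG : RulesOK G) {o₁ o₂ : Occ} (h₁ : o₁.Avail (addModT W) (3 * W) K Γ) (h₂ : o₂.Avail (addModT W) (3 * W) K Γ)
    (hx : ∀ i < W, o₂.inp i = o₁.inp (W + i)) (hy : ∀ i < W, o₂.inp (W + i) = o₁.inp i)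
    (hn : ∀ i < W, o₂.inp (2 * W + i) = o₁.inp (2 * W + i)) :
    G.Yields Γ (ctxSet K (eqW (u W o₁) (u W o₂) W)) ((10 * W + 8) * (K.size + 10)) := by
  have v₁ := avail h₁
  have v₂ := avail h₂
  -- Δ₀: reflexivity lines for all inputs of `o₁`
  set Δ₀ := ctxSet K (eqW o₁.inp o₁.inp (3 * W)) with hΔ₀
  have s0 : G.Yields Γ Δ₀ (3 * W * (K.size + 10)) := Yields.eqW_refl hG.adder K o₁.inp (3 * W)
  have hr : ∀ j < 3 * W, ctx K (eqv (o₁.inp j) (o₁.inp j)) ∈ Δ₀ := fun j hj => mem_ctxSet (mem_eqW hj)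
  -- Δ₁: adder commutativity
  set Δ₁ := ctxSet K ((List.range (2 * W + 1)).map fun k => eqv ((A W o₁).wire k) ((A W o₂).wire k)) with hΔ₁
  have s1 : G.Yields (Γ ∪ Δ₀) Δ₁ ((2 * W + 1) * (K.size + 10)) := by
    refine Yields.of_isBlock (Adder.isBlock_commLines hG.netlist hG.adder (A W o₁) (A W o₂) (v₁.adder.mono Set.subset_union_left)
      (v₂.adder.mono Set.subset_union_left) (fun i hi => ?_) fun i hi => ?_) ?_ (Adder.proofSize_commLines _ _ _ _)
    · show ctx K (eqv (o₁.inp i) (o₂.inp (W + i))) ∈ Γ ∪ Δ₀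
      rw [hy i hi]; exact Or.inr (hr i (by omega))
    · show ctx K (eqv (o₁.inp (W + i)) (o₂.inp i)) ∈ Γ ∪ Δ₀
      rw [hx i hi]; exact Or.inr (hr (W + i) (by omega))
    · rintro θ ⟨L, hL, rfl⟩
      obtain ⟨k, hk, rfl⟩ := List.mem_map.1 hL
      exact Adder.mem_commLines (List.mem_range.1 hk)
  have ha : ∀ k < 2 * W + 1, ctx K (eqv ((A W o₁).wire k) ((A W o₂).wire k)) ∈ Δ₁ := fun k hk =>
    mem_ctxSet (List.mem_map.2 ⟨k, List.mem_range.2 hk, rfl⟩)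
  -- Δ₂: the `⊥` gates
  set Δ₂ : Set (PropForm ℕ) := {ctx K (eqv (f W o₁) (f W o₂))} with hΔ₂
  have s2 : G.Yields (Γ ∪ (Δ₀ ∪ Δ₁)) Δ₂ (K.size + 10) := by
    have h := Yields.single (FregeSystem.IsInferredFrom.of_rule (hG.netlist _ (rLeib_mem_rules (Kind.cst false))) (S := Γ ∪ (Δ₀ ∪ Δ₁))
      (FregeSystem.sub [K, var (f W o₁), const true, const true, const true, var (f W o₂)]) (θ := ctx K (eqv (f W o₁) (f W o₂))) rfl
      (FregeSystem.prems_cons (Or.inl v₁.bot) (FregeSystem.prems_cons (Or.inl v₂.bot) FregeSystem.prems_nil)))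
    exact h.mono_size (by simp [ctx, eqv, size, FregeSystem.size_biimp])
  -- Δ₃: the comparator/subtractor
  set Δ₃ := ctxSet K ((List.range (2 * (W + 1) + 1)).map fun k =>
    eqv (((S W o₁).adder (W + 1)).wire k) (((S W o₂).adder (W + 1)).wire k)) with hΔ₃
  have s3 : G.Yields (Γ ∪ ((Δ₀ ∪ Δ₁) ∪ Δ₂)) Δ₃ ((3 * (W + 1) + 1) * (K.size + 10)) := by
    refine Yields.of_isBlock (Sub.isBlock_leibLines hG.netlist hG.logic (S W o₁) (S W o₂)
      (v₁.cmp.mono Set.subset_union_left) (v₂.cmp.mono Set.subset_union_left) (fun i hi => ?_) fun i hi => ?_) ?_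
      (Sub.proofSize_leibLines _ _ _ _)
    · show ctx K (eqv (Adder.extOut (A W o₁) W i) (Adder.extOut (A W o₂) W i)) ∈ Γ ∪ ((Δ₀ ∪ Δ₁) ∪ Δ₂)
      rcases Nat.lt_succ_iff_lt_or_eq.1 hi with hi' | hi'
      · rw [Adder.extOut_lt _ hi', Adder.extOut_lt _ hi']; exact Or.inr (Or.inl (Or.inr (ha (2 * i + 1) (by omega))))
      · rw [hi', Adder.extOut_top, Adder.extOut_top]; exact Or.inr (Or.inl (Or.inr (ha (2 * W) (by omega))))
    · show ctx K (eqv (Adder.zext (nv W o₁) (f W o₁) W i) (Adder.zext (nv W o₂) (f W o₂) W i)) ∈ Γ ∪ ((Δ₀ ∪ Δ₁) ∪ Δ₂)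
      rcases Nat.lt_succ_iff_lt_or_eq.1 hi with hi' | hi'
      · rw [Adder.zext_lt _ _ hi', Adder.zext_lt _ _ hi']
        show ctx K (eqv (o₁.inp (2 * W + i)) (o₂.inp (2 * W + i))) ∈ Γ ∪ ((Δ₀ ∪ Δ₁) ∪ Δ₂)
        rw [hn i hi']; exact Or.inr (Or.inl (Or.inl (hr _ (by omega))))
      · rw [hi', Adder.zext_top, Adder.zext_top]; exact Or.inr (Or.inr rfl)
    · rintro θ ⟨L, hL, rfl⟩
      obtain ⟨k, hk, rfl⟩ := List.mem_map.1 hL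
      exact Sub.mem_leibLines (List.mem_range.1 hk)
  have hs : ∀ k < 2 * (W + 1) + 1, ctx K (eqv (((S W o₁).adder (W + 1)).wire k) (((S W o₂).adder (W + 1)).wire k)) ∈ Δ₃ :=
    fun k hk => mem_ctxSet (List.mem_map.2 ⟨k, List.mem_range.2 hk, rfl⟩)
  -- Δ₄: the multiplexers
  have s4 : G.Yields (Γ ∪ (((Δ₀ ∪ Δ₁) ∪ Δ₂) ∪ Δ₃)) (ctxSet K (eqW (u W o₁) (u W o₂) W)) (W * (K.size + 9 + 1)) := by
    refine Yields.ctx_range (fun i hi => Or.inr ?_) fun i _ => (size_eqv _ _).le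
    refine FregeSystem.IsInferredFrom.of_rule (hG.netlist _ (rLeib_mem_rules Kind.mux))
      (FregeSystem.sub [K, var (u W o₁ i), var (sel W o₁), var (d W o₁ i), var ((A W o₁).s i), var (u W o₂ i), var (sel W o₂),
        var (d W o₂ i), var ((A W o₂).s i)]) rfl
      (FregeSystem.prems_cons ?_ (FregeSystem.prems_cons ?_ (FregeSystem.prems_cons ?_ (FregeSystem.prems_cons ?_
        (FregeSystem.prems_cons ?_ FregeSystem.prems_nil)))))
    · exact Or.inl (v₁.mux i hi)
    · exact Or.inl (v₂.mux i hi)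
    · exact Or.inr (Or.inr (hs (2 * (W + 1)) (by omega)))
    · exact Or.inr (Or.inr (hs (2 * i + 1) (by omega)))
    · exact Or.inr (Or.inl (Or.inl (Or.inr (ha (2 * i + 1) (by omega)))))
  have h := (((s0.trans s1).trans s2).trans s3).trans s4
  refine (h.mono_right ?_).mono_size (by nlinarith)
  intro θ hθ; exact Or.inr hθ

/-! ### Law: zero is a left unit of modular addition on words below `n` -/

/-- **`0 ⊕ₙ x = x` inside Frege**: for an occurrence on `(z, x)` with `z` provably zero and `x < n`
certified, the result is provably `x`: the adder returns `x` without carry, so `s = x < n`, the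
selector is false and the multiplexers return `s`. [cite: CookReckhow1979, §2] [cite: Krajicek1995, §9.2] -/
theorem unitL (hG : RulesOK G) {o : Occ} (ho : o.Avail (addModT W) (3 * W) K Γ)
    (hz : Holds K Γ (litW o.inp (fun _ => false) W)) (hx : LtN W K Γ (fun i => o.inp (W + i)) (nv W o)) :
    G.Yields Γ (ctxSet K (eqW (u W o) (fun i => o.inp (W + i)) W)) ((9 * W + 18) * (K.size + 10)) := by
  have v := avail ho
  -- t1: reflexivity of `n`, the literal of the `⊥` gate, the zero-left law of the adder
  set Δn := ctxSet K (eqW (nv W o) (nv W o) W) with hΔn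
  set Δf : Set (PropForm ℕ) := {ctx K (lit (f W o) false)} with hΔf
  set Δ₀ := ctxSet K ((List.range (2 * W + 1)).map (zeroLLine (A W o))) with hΔ₀
  have t1 : G.Yields Γ ((Δn ∪ Δf) ∪ Δ₀) (W * (K.size + 10) + (K.size + 3) + (2 * W + 1) * (K.size + 10)) :=
    ((Yields.eqW_refl hG.adder K (nv W o) W).union (Yields.lit_of_cstDef hG.logic v.bot)).union
      (zeroL hG (A W o) v.adder fun i hi => holds_litW_iff.1 hz i hi)
  have hn : ∀ i < W, ctx K (eqv (nv W o i) (nv W o i)) ∈ Δn := fun i hi => mem_ctxSet (mem_eqW hi)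
  have hsum : ∀ i < W, ctx K (eqv ((A W o).s i) (o.inp (W + i))) ∈ Δ₀ := fun i hi => mem_ctxSet (sum_mem_zeroL (A W o) hi)
  have hcar : ∀ i ≤ W, ctx K (neg (var ((A W o).c i))) ∈ Δ₀ := fun i hi => mem_ctxSet (carry_mem_zeroL (A W o) hi)
  -- t2: the sum equalities, reversed
  set Δ₀' := ctxSet K (eqW (fun i => o.inp (W + i)) (A W o).s W) with hΔ₀'
  have t2 : G.Yields (Γ ∪ ((Δn ∪ Δf) ∪ Δ₀)) Δ₀' (W * (K.size + 10)) :=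
    Yields.eqW_symm hG.logic (holds_eqW_iff.2 fun i hi => by have := hsum i hi; simp only [Set.mem_union]; tauto)
  have hsum' : ∀ i < W, ctx K (eqv (o.inp (W + i)) ((A W o).s i)) ∈ Δ₀' := fun i hi => mem_ctxSet (mem_eqW (a := fun i => o.inp (W + i)) hi)
  -- t3: the low comparison `s < n` transported from the certificate of `x`
  have t3 : G.Yields (Γ ∪ (((Δn ∪ Δf) ∪ Δ₀) ∪ Δ₀')) {ctx K (neg (var ((S W o).ge (W + 1) W)))} ((3 * W + 2) * (K.size + 10)) := by
    refine (hx.mono Set.subset_union_left).transport hG (S W o) (v.cmp.mono Set.subset_union_left) (Nat.le_succ W)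
      (fun i hi => ?_) fun i hi => ?_
    · show ctx K (eqv (o.inp (W + i)) (Adder.extOut (A W o) W i)) ∈ _
      rw [Adder.extOut_lt _ hi]; have := hsum' i hi; simp only [Set.mem_union]; tauto
    · show ctx K (eqv (nv W o i) (Adder.zext (nv W o) (f W o) W i)) ∈ _
      rw [Adder.zext_lt _ _ hi]; have := hn i hi; simp only [Set.mem_union]; tauto
  -- t4: the top position of the comparator: `ge (W+1) ↔ ge W`
  have t4 : G.Yields (Γ ∪ ((((Δn ∪ Δf) ∪ Δ₀) ∪ Δ₀') ∪ {ctx K (neg (var ((S W o).ge (W + 1) W)))}))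
      {ctx K (eqv (sel W o) ((S W o).ge (W + 1) W))} (K.size + 10) := by
    refine topEqv hG (S W o) (v.cmp.mono Set.subset_union_left) ?_ ?_
    · show ctx K (neg (var (Adder.extOut (A W o) W W))) ∈ _
      rw [Adder.extOut_top]; have := hcar W le_rfl; simp only [Set.mem_union]; tauto
    · show ctx K (neg (var (Adder.zext (nv W o) (f W o) W W))) ∈ _
      rw [Adder.zext_top]; simp only [Set.mem_union, hΔf, Set.mem_singleton_iff]; tauto
  -- t5: symmetry, then `¬sel`
  have t5 : G.Yields (Γ ∪ (((((Δn ∪ Δf) ∪ Δ₀) ∪ Δ₀') ∪ {ctx K (neg (var ((S W o).ge (W + 1) W)))}) ∪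
      {ctx K (eqv (sel W o) ((S W o).ge (W + 1) W))})) {ctx K (neg (var (sel W o)))} (K.size + 10 + (K.size + 10)) := by
    have ha : G.Yields (Γ ∪ (((((Δn ∪ Δf) ∪ Δ₀) ∪ Δ₀') ∪ {ctx K (neg (var ((S W o).ge (W + 1) W)))}) ∪
        {ctx K (eqv (sel W o) ((S W o).ge (W + 1) W))})) {ctx K (eqv ((S W o).ge (W + 1) W) (sel W o))} (K.size + 10) := by
      have h := Yields.single (Logic.infer hG.logic 5 (by decide) (S := Γ ∪ (((((Δn ∪ Δf) ∪ Δ₀) ∪ Δ₀') ∪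
          {ctx K (neg (var ((S W o).ge (W + 1) W)))}) ∪ {ctx K (eqv (sel W o) ((S W o).ge (W + 1) W))}))
        (FregeSystem.sub [K, var (sel W o), var ((S W o).ge (W + 1) W)]) (θ := ctx K (eqv ((S W o).ge (W + 1) W) (sel W o))) rfl
        (FregeSystem.prems_cons (by simp only [Set.mem_union, Set.mem_singleton_iff]; tauto) FregeSystem.prems_nil))
      exact h.mono_size (by simp [ctx, eqv, size, FregeSystem.size_biimp])
    refine (ha.trans ?_).mono_right Set.subset_union_right
    have h := Yields.single (Logic.infer hG.logic 8 (by decide) (S := Γ ∪ (((((Δn ∪ Δf) ∪ Δ₀) ∪ Δ₀') ∪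
        {ctx K (neg (var ((S W o).ge (W + 1) W)))}) ∪ {ctx K (eqv (sel W o) ((S W o).ge (W + 1) W))}) ∪
        {ctx K (eqv ((S W o).ge (W + 1) W) (sel W o))})
      (FregeSystem.sub [K, var ((S W o).ge (W + 1) W), var (sel W o)]) (θ := ctx K (neg (var (sel W o)))) rfl
      (FregeSystem.prems_cons (by simp only [Set.mem_union, Set.mem_singleton_iff]; tauto)
        (FregeSystem.prems_cons (Or.inr rfl) FregeSystem.prems_nil)))
    exact h.mono_size (by simp [ctx, size])
  -- t6: the multiplexers return `s`, which is `x`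
  have t6 : G.Yields (Γ ∪ ((((((Δn ∪ Δf) ∪ Δ₀) ∪ Δ₀') ∪ {ctx K (neg (var ((S W o).ge (W + 1) W)))}) ∪
      {ctx K (eqv (sel W o) ((S W o).ge (W + 1) W))}) ∪ {ctx K (neg (var (sel W o)))}))
      (ctxSet K (eqW (u W o) (A W o).s W) ∪ ctxSet K (eqW (u W o) (fun i => o.inp (W + i)) W)) (W * (K.size + 10) + W * (K.size + 10)) := by
    refine (Yields.muxRelW_false hG.logic (w₁ := d W o) (holds_muxRelW_iff.2 fun i hi => Or.inl (v.mux i hi))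
      (by simp only [Set.mem_union, Set.mem_singleton_iff]; tauto)).trans ?_
    exact Yields.eqW_trans hG.logic (b := (A W o).s) (holds_eqW_iff.2 fun i hi => Or.inr (mem_ctxSet (mem_eqW hi)))
      (holds_eqW_iff.2 fun i hi => by have := hsum i hi; simp only [Set.mem_union]; tauto)
  have h := ((((t1.trans t2).trans t3).trans t4).trans t5).trans t6
  refine (h.mono_right ?_).mono_size (by nlinarith)
  intro θ hθ; exact Or.inr (Or.inr hθ)

end ModAdd

end Literature.Computability.MetaComplexity
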